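import Summits.KontsevichZagierPeriods.KontsevichZagierPeriods.Theses.EulerFormChain
import Summits.KontsevichZagierPeriods.KontsevichZagierPeriods.Theorems.FurushoPentagonSectorToKernelOfLeaves
import Summits.KontsevichZagierPeriods.KontsevichZagierPeriods.Theorems.HurwitzMicroSectorsNormalFormPrincipleSplitGlue

/-!
# EulerFormChain — SPLIT GLUE of the deciding crux `PiPowerStratum` (stmt-KontsevichZagierPeriods-11792)

Crux-strategist re-audit r1 (RESTATED bin), 2026-08-17.  `PiPowerStratum` — the Tate normal form of
Conjecture 1 — is kernel-checked EQUIVALENT to the summit (`EulerFormChain.closes`; the converse is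
restriction).  BC2 REDIRECT: this file proves, BY NAME over the route decls of
`Theses/EulerFormChain.lean` (rev ≥ 11), the three-piece cut

  `CubeResolution → AyoubCubeLocalKernel → AyoubPiCancellation → PiPowerStratum`

(`piPowerStratum_of_subs`; it closes the glue ITEM `PiPowerStratumOfSubs` = stmt-17590 by name,
`piPowerStratumOfSubs_proof`) along the seams  (geometry inside the rules: every integral representation
is congruent modulo `KZ.relations` to a `ℤ`-combination of tame cube classes, item stmt-17978)  ∣
(the Kontsevich–Ayoub transcendence core on Ayoub-ADMISSIBLE cube classes — one real power series of
polyradius `> 1`, algebraic over `ℚ(x)` — after inverting the disc class `[π]`, item stmt-19074, new)  ∣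
(`[π]` is a non-zero-divisor of `FormalRep ⧸ relations`, item stmt-0540).  It is the common refinement
of the hub's two standing cuts of the summit kernel form: the cube cut `CubeResolution ∧
AyoubEffectiveCubeKernel` (HermiteRigidity / SphericalSchlafli, Ayoub 2015 Conj. 1.1) and the
`π`-localisation cut `AyoubPiLocalKernel ∧ AyoubPiCancellation` (AyoubSpecialisation, stmt-0541 ∧ 0540):
the middle piece is implied by stmt-0541 (restriction to one cube class,
`ayoubCubeLocalKernel_of_ayoubPiLocalKernel`, hence by the summit) and
by stmt-18116 (landed real-Stokes transfer, `N = 0`), and implies neither.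

The glue is not a one-line seam: given KZ-rational `r`, `r'` of equal value, (1) resolve BOTH into the
tame cubical span (X₁); (2) MERGE the difference of the two resolutions to ONE tame cube class
(`ReducedPeriodRing.stub_cubeMerge`, landed) and make it Ayoub-admissible inside the moves
(`SectorToKernel.stub_admissibleOfTame`, landed); (3) its integral is `r.value − r'.value = 0` by
SOUNDNESS (`KZ.relations_le_ker_eval_holds`); (4) X₂ gives a disc-power multiple `([π]⋆)^N [s] ∈
relations` for the pinned disc product, which EXISTS (`exists_pinnedProduct`, landed); (5) X₃ peels the
`N` discs; (6) the five congruences add up to `[r] − [r'] ∈ relations`.  With the route's deciding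
theorem the three leaves give the summit through this route (`kontsevichZagierPeriods_of_subs`).

References: M. Kontsevich, D. Zagier, *Periods* (2001), §1.1–1.2, §4.1; J. Ayoub, EMS Newsl. 91 (2014),
Def. 9–10, Prop. 11, Conj. 7; J. Ayoub, Ann. of Math. 181 (2015), Conj. 1.1; A. Huber, S. Müller-Stach,
*Periods and Nori Motives* (2017), §13.1–13.2; A. Huber, G. Wüstholz, *Transcendence and linear relations
of 1-periods* (2022), App. A.
-/

noncomputable section

namespace Summit.KontsevichZagierPeriods.EulerFormChain.PiPowerStratumOfSubs

open Literature.NumberTheory.Transcendental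
open Literature.NumberTheory.Transcendental.KZ hiding cubicalSpan
open Summit.KontsevichZagierPeriods.FurushoPentagon.ReducedPeriodRing (unitCube cubicalGens cubicalSpan
  stub_cubeMerge)
open Summit.KontsevichZagierPeriods.FurushoPentagon.SectorToKernel
open Summit.KontsevichZagierPeriods.KontsevichZagierPeriods.Theses.EulerFormChain
  (PiPowerStratum CubeResolution AyoubCubeLocalKernel AyoubPiCancellation PiPowerStratumOfSubs)

/-- **π-peeling**: under `AyoubPiCancellation` (stmt-0540), `([π]⋆)^[N] x ∈ relations → x ∈ relations`
for the pinned disc product, by induction on `N`. [cite: KontsevichZagier2001, §4.1] [folklore] -/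
theorem peel_of_piCancellation (h2 : AyoubPiCancellation)
    (P : ∀ n : ℕ, IntegralRep n → IntegralRep (n + 2))
    (hP : ∀ (n : ℕ) (r : IntegralRep n), (P n r).domain = {z : Fin (n + 2) → ℝ | z 0 ^ 2 + z 1 ^ 2 ≤ 1 ∧
        (fun i : Fin n => z i.succ.succ) ∈ r.domain} ∧
      (P n r).integrand = fun z => r.integrand (fun i : Fin n => z i.succ.succ)) :
    ∀ (N : ℕ) (x : FormalRep),
      (⇑(FreeAbelianGroup.lift (fun t : (Σ n, IntegralRep n) => of (P t.1 t.2))))^[N] x ∈ relations →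
        x ∈ relations := by
  intro N
  induction N with
  | zero => intro x hx; simpa using hx
  | succ N ih =>
      intro x hx
      rw [Function.iterate_succ_apply'] at hx
      exact ih x (h2 P hP _ hx)

/-- **THE SPLIT GLUE, by name** — `CubeResolution → AyoubCubeLocalKernel → AyoubPiCancellation →
PiPowerStratum` over the route decls of `Theses/EulerFormChain.lean` (items stmt-17978, stmt-19074,
stmt-0540 ⇒ stmt-11792): resolve both representations, merge, admissible, soundness, localised kernel on
the admissible class, peel the discs, add up.  This is the `--glue-by` theorem of the strategist split of
the deciding crux. [cite: KontsevichZagier2001, §1.2] [cite: Ayoub2014, Def. 9–10, Prop. 11]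
[cite: Ayoub2015, Conj. 1.1] [folklore] -/
theorem piPowerStratum_of_subs :
    CubeResolution → AyoubCubeLocalKernel → AyoubPiCancellation → PiPowerStratum := by
  intro h1 hK h2 n m r r' _hr _hr' hv _hpi
  obtain ⟨P, hP⟩ :=
    Summit.KontsevichZagierPeriods.HurwitzMicroSectors.NormalFormPrincipleSplitGlue.exists_pinnedProduct
  -- (1) resolve both representations into the tame cubical span
  obtain ⟨a, ha, hra⟩ := h1 n r
  obtain ⟨a', ha', hra'⟩ := h1 m r'
  -- (2) merge the difference to one tame cube class `t`, then to an admissible class `s`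
  have hc : a - a' ∈ cubicalSpan := cubicalSpan.sub_mem ha ha'
  obtain ⟨k, t, htd, hta, hct⟩ := stub_cubeMerge (a - a') hc
  rw [leaves_unitCube_eq_cube] at htd hta
  obtain ⟨s, hsd, hadm, hts⟩ := stub_admissibleOfTame k t htd hta
  -- (3) soundness: `s.value = 0`
  have hs0 : s.value = 0 := by
    have e1 : eval (of r - a) = 0 := relations_le_ker_eval_holds hra
    have e2 : eval (of r' - a') = 0 := relations_le_ker_eval_holds hra'
    have e3 : eval (a - a' - of t) = 0 := relations_le_ker_eval_holds hct
    have e4 : eval (of t - of s) = 0 := relations_le_ker_eval_holds hts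
    simp only [map_sub, eval_of] at e1 e2 e3 e4
    linarith
  -- (4) the localised kernel on the admissible cube class
  obtain ⟨N, hN⟩ := hK P hP k s hsd hadm hs0
  -- (5) peel the discs
  have hs : of s ∈ relations := peel_of_piCancellation h2 P hP N (of s) hN
  -- (6) add up
  show of r - of r' ∈ relations
  have key : of r - of r' = (of r - a) - (of r' - a') + (a - a' - of t) + (of t - of s) + of s := by
    abel
  rw [key]
  exact relations.add_mem (relations.add_mem (relations.add_mem (relations.sub_mem hra hra') hct) hts) hs

/-- **The summit from the three leaves, through this route**: split glue followed by the route's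
deciding theorem `EulerFormChain.closes : PiPowerStratum → KontsevichZagierPeriods`.
[cite: KontsevichZagier2001, §1.2] [folklore] -/
theorem kontsevichZagierPeriods_of_subs (h1 : CubeResolution) (hK : AyoubCubeLocalKernel)
    (h2 : AyoubPiCancellation) : _root_.KontsevichZagierPeriods :=
  Summit.KontsevichZagierPeriods.KontsevichZagierPeriods.Theses.EulerFormChain.closes
    (piPowerStratum_of_subs h1 hK h2)

/-- **Position of the new piece** — `AyoubPiLocalKernel → AyoubCubeLocalKernel` (stmt-0541 ⇒
stmt-19074), the antecedent written out verbatim (the body of `LiouvilleUnfolding.AyoubPiLocalKernel` /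
`AyoubSpecialisation.AyoubPiLocalKernel`): restrict the localised kernel form to the single admissible
cube class `c := [s]` (`eval [s] = s.value`).  In particular the piece is a consequence of the summit
(landed `summit_iff_ayoubPiLocalKernel_and_ayoubPiCancellation`), refutable only by refuting
Conjecture 1 itself. [cite: Ayoub2014, Conj. 7] [folklore] -/
theorem ayoubCubeLocalKernel_of_ayoubPiLocalKernel
    (h : ∀ (P : ∀ n : ℕ, Literature.NumberTheory.Transcendental.KZ.IntegralRep n → Literature.NumberTheory.Transcendental.KZ.IntegralRep (n + 2)), (∀ (n : ℕ) (r : Literature.NumberTheory.Transcendental.KZ.IntegralRep n), (P n r).domain = {z : Fin (n + 2) → ℝ | z 0 ^ 2 + z 1 ^ 2 ≤ 1 ∧ (fun i : Fin n => z i.succ.succ) ∈ r.domain} ∧ (P n r).integrand = fun z => r.integrand (fun i : Fin n => z i.succ.succ)) → ∀ c : Literature.NumberTheory.Transcendental.KZ.FormalRep, Literature.NumberTheory.Transcendental.KZ.eval c = 0 → ∃ N : ℕ, (⇑(FreeAbelianGroup.lift (fun s : (Σ n, Literature.NumberTheory.Transcendental.KZ.IntegralRep n) => Literature.NumberTheory.Transcendental.KZ.of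 (P s.1 s.2))))^[N] c ∈ Literature.NumberTheory.Transcendental.KZ.relations) :
    AyoubCubeLocalKernel := by
  intro P hP m s _ _ hs0
  exact h P hP (of s) (by rw [eval_of, hs0])

/-- **The glue ITEM by name** — `EulerFormChain.PiPowerStratumOfSubs` (stmt-KontsevichZagierPeriods-17590, support r9:
`CubeResolution → AyoubCubeLocalKernel → AyoubPiCancellation → PiPowerStratum`), closed by the split glue.
[cite: KontsevichZagier2001, §1.2] [folklore] -/
theorem piPowerStratumOfSubs_proof : PiPowerStratumOfSubs :=
  fun h1 hK h2 => piPowerStratum_of_subs h1 hK h2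

end Summit.KontsevichZagierPeriods.EulerFormChain.PiPowerStratumOfSubs
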